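import Summits.QuantumFields.BalabanUV.Beta.FP.TowerNWardOfLetters
import Summits.QuantumFields.BalabanUV.Beta.FP.TowerRootCentredComposed
import Summits.QuantumFields.BalabanUV.Beta.CompositeMixedWardClass
import Summits.QuantumFields.BalabanUV.Beta.WilsonBiStencilWardSocketPins
import Summits.QuantumFields.BalabanUV.Beta.CompositeVertexWardSymTwoBricks
import Summits.QuantumFields.BalabanUV.Beta.CompositeOneShotJetsGraded
import Summits.QuantumFields.BalabanUV.Beta.WardLocusSymSockets
import Summits.QuantumFields.BalabanUV.Beta.KernelWardMColumn

/-!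
# `BalabanUV.Beta.FP.TowerNWardOfStencilLaw` — row D1 ∕ (C1) OWNER «beta-an2», PART 118, ROUTE T (β1): **THE `hW𝒯 j` END WITH THE TRANSPORTED LAW `hD` DISCHARGED (generic
# tables), AND ITS INSTANTIATION AT THE RECORD's (0.4)-SYMMETRISED GRADED COMPOSITE TABLES FROM THE (S)-LAW ALONE** — at the centred tower, for the sym tables `compV ∕ compH ∕ compB ∕
# compMixG` of `CompositeOneShotJets[Graded]`, the `hW𝒯 j`-shaped Ward transversality follows from ONE displayed law, PART 103's `hSd` ((S)_j, LOCATED for these tables: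
# FINDING AN2-86-1), plus five pin rows and `2 ≤ N_c`

HONEST DEPENDENCY (page 1, mandatory): continuum YM on T⁴ ⇐ BetaPertH ∧ nine spine estimates (0/9 proved); BetaPertH ⇐ (D1) ∧ (D4) ∧ CAP+tail;
G-an2-4 gates asym, D1 and NE2/3/4.  HONEST FRAMING (cell contract, verbatim): «discharging `BetaPertH` makes Bałaban's UV stability UNCONDITIONAL —
a real constructive-QFT result; it is NOT the continuum limit and NOT the Clay problem.»  ABSOLUTE RULE (cell charter, verbatim): «No internally-minted
statement may enter as a cited fact. Every hypothesis is either kernel-proved in this package or a verbatim quotation of a PUBLISHED theorem with page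
reference. The manuscript(s) under audit are NOT citable for their own disputed steps — they are the thing under adjudication; programme-internal
(2001/route/tribunal) claims are never citable.»

WHY (an2 gen 87; memo `gen87/HWD-INVENTORY-87.md` §2).  PART 115 displays two (S)-type laws: `hSd` (member-0 stencil family vs `bhKcomp`) and `hD` (the same transported through
`dM (AN R j) …`).  The second follows from the first for ANY tables by an1's `KernelWardMColumn.divV_dM_eq_conjV` (chart side: `colM_ward_AN`, `colH_ward_AN`, decay of `AN`) once the
Λ-sector's divergence is seen to be null (an2 g29 `WardLocusSymSockets.divV_SpureRecOf_eq_divV_SrecOf`): §1 **`wardTransversal_AN_of_stencilLaw`** = PART 115 with `hD` DISCHARGED.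
§2 **`wardTransversal_AN_sym_of_stencilLaw`**: at the centred tower `Roots.ctr Lc` and the record's SYM bricks (root `ctrOff 4 Lc` at every level; tables `compV ∕ compH ∕ compB ∕ compMixG
(ctrOff 4 Lc) Lc (j+1)` — the graded mixed table, FINDING AN2-86-2), every (W)_j letter is a tree theorem — Wilson PART 114, border PART 117 `hBord_compB_sym` (+ PART 109's composed-root
lemma), mixed PART 110d∕110g∕111 `…_sym`, (c1)₀ PART 113, (V-p)(H-p) `CompositeTablesParity.…_sym`, table letters F3∕F5c∕F6a∕(F0) `compV_hV … compMixG_hmix ∕ _translate` — so the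
`hW𝒯 j`-shaped conclusion follows from `hSd` ALONE plus the pin rows {`cE² = cE₂`, `2·cB = cE·cVH`, `T = (8N_c²)⁻¹ • wsym22 N_c`, `cM 0 = cΛ`, `cΛ·cE = 2`} (the (S) pin `2·cVH = −(Lc⁴)^(j+1)·cE` lives inside `hSd`).
READING: for these SYM tables `hSd` is exactly the LOCATED law of FINDING AN2-86-1 (the sym V-table's Ward law is against the SYM composite rows, `bhKcomp`'s border is the rooted-plain
rows); so at a graded sym record (`S`∕`W` = §2's families by `rfl`) the END's `hW𝒯 j` is EQUIVALENT-BY-NAME to the one located first-order law — the census sentence.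

WHAT: [folklore] composition BY NAME; no `def`, no `def … : Prop`, nothing cited, 0 sorry.  `hSd` for the sym tables is DISPLAYED, NOT claimed (located; PREDICTION-AN2-86a: by value
TEL2 C10 (R)∕(G) OPENS); nothing of Bałaban's asserted, valued or discharged; 0 estimates; 0∕4 row-D1 binders; `hW𝒯 (j ≥ 1)` NOT claimed at any record; NOT (C1), NOT (T-ID),
NOT D1, NEVER «G-an2-4 closed», NOT BetaPertH, NOT continuum, NOT Clay.  Row D1 ∕ (C1) OWNER «beta-an2», gen 87, 2026-08-30.  No existing file touched.
-/

noncomputable section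

open Finset
open scoped BigOperators
open Literature.MathematicalPhysics.QuantumFieldTheory
open Literature.MathematicalPhysics.QuantumFieldTheory.Balaban1983to89
open Literature.MathematicalPhysics.QuantumFieldTheory.Balaban1983to89.Beta
open ExpKernelCalculus (MKer Decays BiLoc comp hessKer VertexFamily shiftK)
open PolarizationSign (WardTransversal)
open KernelWard (divV bdd_of_biLoc)
open AffineAveraging (Site box toSite)
open AveragingContoursRooted (ctrOff)
open OneStepResolventKernel (Fib LocStencil)
open OneStepKernelFamily (colH vertexOfK flipK)
open BalabanCompositeJets (LocStencil₂)
open SecondOrderResponse (colM dM LocStencilFM)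
open BalabanStepW2 (M2Of)
open StepJetData (wilsonA biLoc_weaken)
open WilsonBiStencil (wilsonW₂)
open WilsonVertex2Sym (wsym22)
open HessKerRate (biLoc_zero)
open Summit.QuantumFields.BalabanUV.Beta.TameKernelCalculus (trK)
open Summit.QuantumFields.BalabanUV.Beta.BorderedHessian (diagK sgnK)
open Summit.QuantumFields.BalabanUV.Beta.ChartConjugation (conjV)
open Summit.QuantumFields.BalabanUV.Beta.AxialDressingRooted (one_le_of_neZero)
open Summit.QuantumFields.BalabanUV.Beta.RelInvComposite (bhKcomp)
open Summit.QuantumFields.BalabanUV.Beta.AveragingWardRootedStencils (legInd)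
open Summit.QuantumFields.BalabanUV.Beta.SpineRooted (SpureRecOf WrecOf S0NOf locStencil_SpureRecOf)
open Summit.QuantumFields.BalabanUV.Beta.WardLocusRecursive (SrecOf SrecOf_zero)
open Summit.QuantumFields.BalabanUV.Beta.SpineRecursiveParity (parityOdd_zero)
open Summit.QuantumFields.BalabanUV.Beta.SymAveragingHessianCounts (symLinKerAt symVhKerAt symHessKerAt biLoc_smul_ff)
open Summit.QuantumFields.BalabanUV.Beta.SymAveragingMixedJetTables (symMixKerAt)
open Summit.QuantumFields.BalabanUV.Beta.CompositeVertexKernelRec (compVhS)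
open Summit.QuantumFields.BalabanUV.Beta.CompositeHessianTable (compHessFF)
open Summit.QuantumFields.BalabanUV.Beta.CompositeTablesParity (trK_compVhS_sym trK_compHessFF_sym)
open Summit.QuantumFields.BalabanUV.Beta.CompositeMixedTableGraded (compMixFFG compMixG)
open Summit.QuantumFields.BalabanUV.Beta.CompositeMixedTableGradedBounds (compMixG_hmix)
open Summit.QuantumFields.BalabanUV.Beta.CompositeMixedTableGradedCov (compMixG_translate)
open Summit.QuantumFields.BalabanUV.Beta.CompositeOneShotJets (compV compH compB compV_hV compH_hH compB_hB compV_hVt compH_hHt compB_hBt)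
open Summit.QuantumFields.BalabanUV.Beta.CompositeOneShotJetData (Roots AN)
open Summit.QuantumFields.BalabanUV.Beta.NVertexSectors (decays_AN)
open Summit.QuantumFields.BalabanUV.Beta.WardLocusSymSockets (divV_SpureRecOf_eq_divV_SrecOf)
open Summit.QuantumFields.BalabanUV.Beta.KernelWardMColumn (divV_dM_eq_conjV)
open Summit.QuantumFields.BalabanUV.Beta.CompositeMixedWardClass (M2Of_member_zero vertexFamily_mixedLetterRemainder_sym parityOdd_mixedLetterRemainder_sym)
open Summit.QuantumFields.BalabanUV.Beta.WilsonBiStencilWardSocketPins (hWil_wsym22_TW_su hWil''_wsym22_TW_su)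
open Summit.QuantumFields.BalabanUV.Beta.CompositeVertexWardSymTwoBricks (hBord_compB_sym hBord''_compB_sym)
open Summit.QuantumFields.BalabanUV.Beta.FP.TowerNColumnWardLaw (colH_ward_AN colM_ward_AN)
open Summit.QuantumFields.BalabanUV.Beta.FP.TowerRootCentredComposed (ctr_composedRoot_eq_s)
open Summit.QuantumFields.BalabanUV.Beta.FP.TowerNWardOfLetters (wardTransversal_AN_of_letters)

namespace Summit.QuantumFields.BalabanUV.Beta.FP.TowerNWardOfStencilLaw

/-! ## §1 Generic tables: the transported law `hD` discharged -/

section Generic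

variable {Lc : ℕ} [NeZero Lc] (R : Roots Lc) (j : ℕ)

/-- [folklore] **`wardTransversal_AN_of_stencilLaw` — PART 115 WITH `hD` DISCHARGED**: for generic composite-triple tables (letters as in PART 115), the (S)-law `hSd` of the member-0
stencil family implies its transported form (`divV_SpureRecOf_eq_divV_SrecOf` — the Λ-sector's divergence is null — then an1's `divV_dM_eq_conjV` over the composite chart's
multiplier-column Ward null `colM_ward_AN` and ℋ-column law `colH_ward_AN`); the displayed list is `hSd` + the three (W) letters. -/
theorem wardTransversal_AN_of_stencilLaw
    {V H : Fin (3 + 1) → (Fin (3 + 1) → ℤ) → MKer (3 + 1) (Fib 3)}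
    (hV : ∀ δ : ℝ, 0 ≤ δ → ∃ C : ℝ, LocStencil V C δ) (hH : ∀ δ : ℝ, 0 ≤ δ → ∃ C : ℝ, VertexFamily H (Lc ^ (j + 1)) C δ)
    (hVt : ∀ (κ : Fin (3 + 1)) (u t : Fin (3 + 1) → ℤ), V κ (u + (((Lc ^ (j + 1) : ℕ) : ℤ)) • t) = shiftK (-((((Lc ^ (j + 1) : ℕ) : ℤ)) • t)) (V κ u))
    (hHt : ∀ (μ : Fin (3 + 1)) (y t : Fin (3 + 1) → ℤ), H μ (y + t) = shiftK (-((((Lc ^ (j + 1) : ℕ) : ℤ)) • t)) (H μ y))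
    (hVp : ∀ (κ : Fin (3 + 1)) (u : Fin (3 + 1) → ℤ), trK (V κ u) = -sgnK (V κ u))
    (hHp : ∀ (μ : Fin (3 + 1)) (y : Fin (3 + 1) → ℤ), trK (H μ y) = -sgnK (H μ y))
    {M : ℕ → Fin (3 + 1) → (Fin (3 + 1) → ℤ) → MKer (3 + 1) (Fib 3)} (hM : ∀ j' : ℕ, ∃ CM δ : ℝ, 0 < δ ∧ VertexFamily (M j') (Lc ^ (j + 1)) CM δ)
    (hMt : ∀ (j' : ℕ) (μ : Fin (3 + 1)) (w t : Fin (3 + 1) → ℤ), M j' μ (w + t) = shiftK (-((((Lc ^ (j + 1) : ℕ) : ℤ)) • t)) (M j' μ w))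
    (cE cVH cΛ cE₂ cB : ℝ) (hM0 : M 0 = cΛ • H) (T : Fin 4 → Fin 4 → Fin 4 → Fin 4 → ℝ)
    {vh₂S : Fin (3 + 1) → (Fin (3 + 1) → ℤ) → Fin (3 + 1) → (Fin (3 + 1) → ℤ) → MKer (3 + 1) (Fib 3)} (hB : ∃ C δ : ℝ, 0 < δ ∧ LocStencil₂ vh₂S C δ)
    (hBt : ∀ (κ : Fin (3 + 1)) (u : Fin (3 + 1) → ℤ) (κ' : Fin (3 + 1)) (u' t : Fin (3 + 1) → ℤ),
      vh₂S κ (u + (((Lc ^ (j + 1) : ℕ) : ℤ)) • t) κ' (u' + (((Lc ^ (j + 1) : ℕ) : ℤ)) • t) = shiftK (-((((Lc ^ (j + 1) : ℕ) : ℤ)) • t)) (vh₂S κ u κ' u'))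
    {mixFF : Fin (3 + 1) → (Fin (3 + 1) → ℤ) → Fin (3 + 1) → (Fin (3 + 1) → ℤ) → MKer (3 + 1) (Fib 3)} (hmix : ∃ C δ : ℝ, 0 < δ ∧ LocStencilFM (Lc ^ (j + 1)) mixFF C δ)
    (hmixt : ∀ (κ : Fin (3 + 1)) (u : Fin (3 + 1) → ℤ) (μ : Fin (3 + 1)) (w t : Fin (3 + 1) → ℤ),
      mixFF κ (u + (((Lc ^ (j + 1) : ℕ) : ℤ)) • t) μ (w + t) = shiftK (-((((Lc ^ (j + 1) : ℕ) : ℤ)) • t)) (mixFF κ u μ w))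
    (ξ : ℝ)
    (hSd : ∀ y : Fin (3 + 1) → ℤ, ((((Lc ^ (j + 1) : ℕ) : ℝ)) ^ (3 + 1))⁻¹ • ∑ v ∈ box (3 + 1) (Lc ^ (j + 1)),
        divV (SrecOf 3 (Lc ^ (j + 1)) V H (fun _ => AN R j) cE cVH cΛ 0) ((((Lc ^ (j + 1) : ℕ) : ℤ)) • y + toSite v)
      = conjV (bhKcomp (d := 3) R.rc Lc (j + 1)) (diagK (ξ • ∑ v ∈ box (3 + 1) (Lc ^ (j + 1)), legInd (toSite (R.s (j + 1))) ((((Lc ^ (j + 1) : ℕ) : ℤ)) • y + toSite v))))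
    {RW RW'' RB RB'' : (Fin (3 + 1) → ℤ) → Fin (3 + 1) → (Fin (3 + 1) → ℤ) → MKer (3 + 1) (Fib 3)}
    {RM : (Fin (3 + 1) → ℤ) → Fin (3 + 1) → (Fin (3 + 1) → ℤ) → MKer (3 + 1) (Fib 3)}
    (hcls0 : ∃ C δ : ℝ, 0 < δ ∧ (∀ Y, LocStencil (RW Y) C δ) ∧ (∀ Y, LocStencil (RW'' Y) C δ) ∧ (∀ Y, LocStencil (RB Y) C δ) ∧
      (∀ Y, LocStencil (RB'' Y) C δ) ∧ (∀ y, VertexFamily (RM y) (Lc ^ (j + 1)) C δ))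
    (hRWp : ∀ Y κ u, trK (RW Y κ u) = -sgnK (RW Y κ u)) (hRW''p : ∀ Y κ u, trK (RW'' Y κ u) = -sgnK (RW'' Y κ u))
    (hRBp : ∀ Y κ u, trK (RB Y κ u) = -sgnK (RB Y κ u)) (hRB''p : ∀ Y κ u, trK (RB'' Y κ u) = -sgnK (RB'' Y κ u))
    (hRMp : ∀ y ρ' w, trK (RM y ρ' w) = -sgnK (RM y ρ' w))
    (hWil : ∀ (Y : Fin (3 + 1) → ℤ) (κ' : Fin (3 + 1)) (u' : Fin (3 + 1) → ℤ),
      ((((Lc ^ (j + 1) : ℕ) : ℝ)) ^ (3 + 1))⁻¹ • ∑ v ∈ box (3 + 1) (Lc ^ (j + 1)), divV (fun κ u => cE₂ • wilsonW₂ 3 T κ u κ' u') ((((Lc ^ (j + 1) : ℕ) : ℤ)) • Y + toSite v) =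
        comp (cE • wilsonA 3 κ' u') (diagK (ξ • ∑ v ∈ box (3 + 1) (Lc ^ (j + 1)), legInd (toSite (R.s (j + 1))) ((((Lc ^ (j + 1) : ℕ) : ℤ)) • Y + toSite v)))
          - comp (diagK (ξ • ∑ v ∈ box (3 + 1) (Lc ^ (j + 1)), legInd (toSite (R.s (j + 1))) ((((Lc ^ (j + 1) : ℕ) : ℤ)) • Y + toSite v))) (cE • wilsonA 3 κ' u') + RW Y κ' u')
    (hWil'' : ∀ (Y : Fin (3 + 1) → ℤ) (κ : Fin (3 + 1)) (u : Fin (3 + 1) → ℤ),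
      ((((Lc ^ (j + 1) : ℕ) : ℝ)) ^ (3 + 1))⁻¹ • ∑ v ∈ box (3 + 1) (Lc ^ (j + 1)), divV (fun κ' u' => cE₂ • wilsonW₂ 3 T κ u κ' u') ((((Lc ^ (j + 1) : ℕ) : ℤ)) • Y + toSite v) =
        comp (cE • wilsonA 3 κ u) (diagK (ξ • ∑ v ∈ box (3 + 1) (Lc ^ (j + 1)), legInd (toSite (R.s (j + 1))) ((((Lc ^ (j + 1) : ℕ) : ℤ)) • Y + toSite v)))
          - comp (diagK (ξ • ∑ v ∈ box (3 + 1) (Lc ^ (j + 1)), legInd (toSite (R.s (j + 1))) ((((Lc ^ (j + 1) : ℕ) : ℤ)) • Y + toSite v))) (cE • wilsonA 3 κ u) + RW'' Y κ u)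
    (hBord : ∀ (Y : Fin (3 + 1) → ℤ) (κ' : Fin (3 + 1)) (u' : Fin (3 + 1) → ℤ),
      ((((Lc ^ (j + 1) : ℕ) : ℝ)) ^ (3 + 1))⁻¹ • ∑ v ∈ box (3 + 1) (Lc ^ (j + 1)), divV (fun κ u => cB • vh₂S κ u κ' u') ((((Lc ^ (j + 1) : ℕ) : ℤ)) • Y + toSite v) =
        comp (cVH • V κ' u') (diagK (ξ • ∑ v ∈ box (3 + 1) (Lc ^ (j + 1)), legInd (toSite (R.s (j + 1))) ((((Lc ^ (j + 1) : ℕ) : ℤ)) • Y + toSite v)))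
          - comp (diagK (ξ • ∑ v ∈ box (3 + 1) (Lc ^ (j + 1)), legInd (toSite (R.s (j + 1))) ((((Lc ^ (j + 1) : ℕ) : ℤ)) • Y + toSite v))) (cVH • V κ' u') + RB Y κ' u')
    (hBord'' : ∀ (Y : Fin (3 + 1) → ℤ) (κ : Fin (3 + 1)) (u : Fin (3 + 1) → ℤ),
      ((((Lc ^ (j + 1) : ℕ) : ℝ)) ^ (3 + 1))⁻¹ • ∑ v ∈ box (3 + 1) (Lc ^ (j + 1)), divV (fun κ' u' => cB • vh₂S κ u κ' u') ((((Lc ^ (j + 1) : ℕ) : ℤ)) • Y + toSite v) =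
        comp (cVH • V κ u) (diagK (ξ • ∑ v ∈ box (3 + 1) (Lc ^ (j + 1)), legInd (toSite (R.s (j + 1))) ((((Lc ^ (j + 1) : ℕ) : ℤ)) • Y + toSite v)))
          - comp (diagK (ξ • ∑ v ∈ box (3 + 1) (Lc ^ (j + 1)), legInd (toSite (R.s (j + 1))) ((((Lc ^ (j + 1) : ℕ) : ℤ)) • Y + toSite v))) (cVH • V κ u) + RB'' Y κ u)
    (hM₂ : ∀ (y : Fin (3 + 1) → ℤ) (ρ' : Fin (3 + 1)) (w : Fin (3 + 1) → ℤ),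
      ((((Lc ^ (j + 1) : ℕ) : ℝ)) ^ (3 + 1))⁻¹ • ∑ v ∈ box (3 + 1) (Lc ^ (j + 1)), divV (fun κ u => M2Of 3 (Lc ^ (j + 1)) mixFF 0 κ u ρ' w) ((((Lc ^ (j + 1) : ℕ) : ℤ)) • y + toSite v) =
        comp (M 0 ρ' w) (diagK (ξ • ∑ v ∈ box (3 + 1) (Lc ^ (j + 1)), legInd (toSite (R.s (j + 1))) ((((Lc ^ (j + 1) : ℕ) : ℤ)) • y + toSite v)))
          - comp (diagK (ξ • ∑ v ∈ box (3 + 1) (Lc ^ (j + 1)), legInd (toSite (R.s (j + 1))) ((((Lc ^ (j + 1) : ℕ) : ℤ)) • y + toSite v))) (M 0 ρ' w) + RM y ρ' w) :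
    WardTransversal (flipK (hessKer (AN R j)
      (vertexOfK (AN R j) (Lc ^ (j + 1)) (SrecOf 3 (Lc ^ (j + 1)) V H (fun _ => AN R j) cE cVH cΛ 0))
      (WrecOf 3 (Lc ^ (j + 1)) (fun _ => AN R j) (SpureRecOf 3 (Lc ^ (j + 1)) V H (fun _ => AN R j) cE cVH cΛ) M cE₂ cB T vh₂S mixFF 0))) := by
  have hN : 1 ≤ Lc ^ (j + 1) := one_le_of_neZero (Lc ^ (j + 1))
  have hG : ∀ j' : ℕ, ∃ δ C : ℝ, 0 < δ ∧ 0 ≤ C ∧ Decays ((fun _ : ℕ => AN R j) j') C δ := fun _ => decays_AN R j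
  -- the pure member-0 family's (S)-law: the Λ-sector's divergence is null
  have hSd' : ∀ y : Fin (3 + 1) → ℤ, ((((Lc ^ (j + 1) : ℕ) : ℝ)) ^ (3 + 1))⁻¹ • ∑ v ∈ box (3 + 1) (Lc ^ (j + 1)),
        divV (SpureRecOf 3 (Lc ^ (j + 1)) V H (fun _ => AN R j) cE cVH cΛ 0) ((((Lc ^ (j + 1) : ℕ) : ℤ)) • y + toSite v)
      = conjV (bhKcomp (d := 3) R.rc Lc (j + 1)) (diagK (ξ • ∑ v ∈ box (3 + 1) (Lc ^ (j + 1)), legInd (toSite (R.s (j + 1))) ((((Lc ^ (j + 1) : ℕ) : ℤ)) • y + toSite v))) := by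
    intro y
    rw [Finset.sum_congr rfl fun v _ => divV_SpureRecOf_eq_divV_SrecOf (G := fun _ => AN R j) hH cE cVH cΛ 0 ((((Lc ^ (j + 1) : ℕ) : ℤ)) • y + toSite v)]
    exact hSd y
  -- a bound on the member-0 multiplier table and the class of the pure family
  obtain ⟨CH, hCH⟩ := hH 0 le_rfl
  have hM₀b : ∀ ρ w x z a b, |M 0 ρ w x z a b| ≤ |cΛ| * CH := by
    intro ρ w x z a b
    rw [hM0]
    simp only [Pi.smul_apply, smul_eq_mul, abs_mul]
    exact mul_le_mul_of_nonneg_left (bdd_of_biLoc (hCH ρ w) le_rfl x z a b) (abs_nonneg _)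
  obtain ⟨Cs, δs, hδs, hS⟩ := locStencil_SpureRecOf (d := 3) (Lc := Lc ^ (j + 1)) hN hV hH hG cE cVH cΛ 0
  have hD : ∀ y : Fin (3 + 1) → ℤ, divV (dM (AN R j) (Lc ^ (j + 1)) (SpureRecOf 3 (Lc ^ (j + 1)) V H (fun _ => AN R j) cE cVH cΛ 0) (M 0)) y =
      conjV (bhKcomp (d := 3) R.rc Lc (j + 1)) (diagK (ξ • ∑ v ∈ box (3 + 1) (Lc ^ (j + 1)), legInd (toSite (R.s (j + 1))) ((((Lc ^ (j + 1) : ℕ) : ℤ)) • y + toSite v))) :=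
    fun y => divV_dM_eq_conjV (N := Lc ^ (j + 1)) (decays_AN R j) hN (fun y ρ w => colM_ward_AN Lc R j y ρ w) hS hδs
      (((((Lc ^ (j + 1) : ℕ) : ℝ)) ^ (3 + 1))⁻¹) (fun y κ' u => colH_ward_AN Lc R j y κ' u) hSd' hM₀b y
  exact wardTransversal_AN_of_letters R j hV hH hVt hHt hVp hHp hM hMt cE cVH cΛ cE₂ cB hM0 T hB hBt hmix hmixt ξ hSd hD hcls0 hRWp hRW''p hRBp hRB''p hRMp
    hWil hWil'' hBord hBord'' hM₂

end Generic

/-! ## §2 The record's (0.4)-symmetrised graded tables at the centred tower: `hW𝒯 j`-shape from the (S)-law ALONE plus pins -/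

section Sym

variable (Lc : ℕ) [NeZero Lc]

/-- [folklore] **`wardTransversal_AN_sym_of_stencilLaw` — AT THE CENTRED TOWER AND THE RECORD's SYM GRADED COMPOSITE TABLES, THE `hW𝒯 j`-SHAPED WARD TRANSVERSALITY FOLLOWS FROM THE
(S)-LAW ALONE + FIVE PIN ROWS** (odd `Lc`, `SU(N_c)` with `2 ≤ N_c`, every depth `j+1`; tables `compV ∕ compH ∕ compB ∕ compMixG (ctrOff 4 Lc) Lc (j+1)` of `CompositeOneShotJets[Graded]`,
multiplier family `cM j′ • compH`).  DISPLAYED: `hSd` — PART 103's (S)-law for `S0NOf 3 N compV compH cE cVH cΛ` against `bhKcomp` with the generator on the big root's legs (for these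
SYM tables this law is LOCATED, FINDING AN2-86-1; it is NOT claimed) — and the pins `hcE₂ hcB hTW hcM0 hΛE`.  Everything else (the three (W)_j letters — Wilson PART 114, border
PART 117, mixed PART 110d∕111 —, (c1)₀ PART 113, the chart side PART 102∕107, the transported law §1) is by name. -/
theorem wardTransversal_AN_sym_of_stencilLaw (hLc : Odd Lc) {Nc : ℕ} (hNc : 2 ≤ Nc) (j : ℕ) (cM : ℕ → ℝ) (cE cVH cΛ cE₂ cB : ℝ)
    {T : Fin 4 → Fin 4 → Fin 4 → Fin 4 → ℝ}
    (hcE₂ : cE ^ 2 = cE₂) (hcB : 2 * cB = cE * cVH)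
    (hTW : T = (8 * (Nc : ℝ) ^ 2)⁻¹ • wsym22 Nc) (hcM0 : cM 0 = cΛ) (hΛE : cΛ * cE = 2)
    (hSd : ∀ y : Fin (3 + 1) → ℤ, ((((Lc ^ (j + 1) : ℕ) : ℝ)) ^ (3 + 1))⁻¹ • ∑ v ∈ box (3 + 1) (Lc ^ (j + 1)),
        divV (S0NOf 3 (Lc ^ (j + 1)) (compV (ctrOff (3 + 1) Lc) Lc (j + 1)) (compH (ctrOff (3 + 1) Lc) Lc (j + 1)) cE cVH cΛ)
          ((((Lc ^ (j + 1) : ℕ) : ℤ)) • y + toSite v)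
      = conjV (bhKcomp (d := 3) (Roots.ctr Lc).rc Lc (j + 1)) (diagK ((((((Lc ^ (j + 1) : ℕ) : ℝ)) ^ (3 + 1))⁻¹ * cE * (1 / 2)) •
          ∑ v ∈ box (3 + 1) (Lc ^ (j + 1)), legInd (toSite ((Roots.ctr Lc).s (j + 1))) ((((Lc ^ (j + 1) : ℕ) : ℤ)) • y + toSite v)))) :
    WardTransversal (flipK (hessKer (AN (Roots.ctr Lc) j)
      (vertexOfK (AN (Roots.ctr Lc) j) (Lc ^ (j + 1))
        (SrecOf 3 (Lc ^ (j + 1)) (compV (ctrOff (3 + 1) Lc) Lc (j + 1)) (compH (ctrOff (3 + 1) Lc) Lc (j + 1)) (fun _ => AN (Roots.ctr Lc) j) cE cVH cΛ 0))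
      (WrecOf 3 (Lc ^ (j + 1)) (fun _ => AN (Roots.ctr Lc) j)
        (SpureRecOf 3 (Lc ^ (j + 1)) (compV (ctrOff (3 + 1) Lc) Lc (j + 1)) (compH (ctrOff (3 + 1) Lc) Lc (j + 1)) (fun _ => AN (Roots.ctr Lc) j) cE cVH cΛ)
        (fun j' μ w => cM j' • compH (ctrOff (3 + 1) Lc) Lc (j + 1) μ w) cE₂ cB T (compB (ctrOff (3 + 1) Lc) Lc (j + 1)) (compMixG (ctrOff (3 + 1) Lc) Lc (j + 1)) 0))) := by
  have hL : 1 ≤ Lc := one_le_of_neZero Lc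
  have hr : ctrOff (3 + 1) Lc ∈ box (3 + 1) Lc := (Roots.ctr Lc).hr
  have hrc : ∀ k : ℕ, (fun _ : ℕ => ctrOff (3 + 1) Lc) k ∈ box (3 + 1) Lc := fun _ => hr
  set cH : ℝ := ((((Lc ^ (j + 1) : ℕ) : ℝ)) ^ (3 + 1))⁻¹ with hcH
  set ξ : ℝ := ((((Lc ^ (j + 1) : ℕ) : ℝ)) ^ (3 + 1))⁻¹ * cE * (1 / 2) with hξ
  -- the composed root of the constant centred root list is the END's big root (PART 109 ∕ chair PROBE-K3)
  have eR : ∑ k ∈ Finset.range (j + 1), ((Lc ^ k : ℕ) : ℤ) • toSite ((fun _ : ℕ => ctrOff (3 + 1) Lc) k) = toSite ((Roots.ctr Lc).s (j + 1)) :=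
    ctr_composedRoot_eq_s hLc (j + 1)
  -- the table letters of the record's sym tables
  have hH : ∀ δ : ℝ, 0 ≤ δ → ∃ C : ℝ, VertexFamily (compH (ctrOff (3 + 1) Lc) Lc (j + 1)) (Lc ^ (j + 1)) C δ := compH_hH (j + 1) hL hr
  have hM : ∀ j' : ℕ, ∃ CM δ : ℝ, 0 < δ ∧ VertexFamily (fun μ w => cM j' • compH (ctrOff (3 + 1) Lc) Lc (j + 1) μ w) (Lc ^ (j + 1)) CM δ := fun j' => by
    obtain ⟨C, hC⟩ := hH 1 zero_le_one
    exact ⟨_, 1, one_pos, fun μ w => biLoc_smul_ff (hC μ w) (cM j')⟩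
  have hMt : ∀ (j' : ℕ) (μ : Fin (3 + 1)) (w t : Fin (3 + 1) → ℤ),
      (fun μ w => cM j' • compH (ctrOff (3 + 1) Lc) Lc (j + 1) μ w) μ (w + t) =
        shiftK (-((((Lc ^ (j + 1) : ℕ) : ℤ)) • t)) ((fun μ w => cM j' • compH (ctrOff (3 + 1) Lc) Lc (j + 1) μ w) μ w) := by
    intro j' μ w t
    funext x z a b
    simp only [Pi.smul_apply, smul_eq_mul, shiftK]
    rw [compH_hHt (j + 1) μ w t]
    rfl
  have hM0 : (fun j' μ w => cM j' • compH (ctrOff (3 + 1) Lc) Lc (j + 1) μ w) 0 = cΛ • compH (ctrOff (3 + 1) Lc) Lc (j + 1) := by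
    funext μ w; simp only [hcM0, Pi.smul_apply]
  -- the scalar locks from the pin rows
  have hlockB : cH * cB = ξ * cVH := by rw [hξ]; linear_combination (((((Lc ^ (j + 1) : ℕ) : ℝ)) ^ (3 + 1))⁻¹ / 2) * hcB
  have hlockM : cH * (1 : ℝ) = ξ * cM 0 := by
    rw [hξ, hcM0]; linear_combination (-(((((Lc ^ (j + 1) : ℕ) : ℝ)) ^ (3 + 1))⁻¹ / 2)) * hΛE
  have hcE₂' : cE₂ = cE ^ 2 := hcE₂.symm
  -- the mixed remainder's identification with PART 111's (`c₂ = 1`, `M2Of … 0` spelled out)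
  have eRM : ∀ (y : Fin (3 + 1) → ℤ) (ρ' : Fin (3 + 1)) (w : Fin (3 + 1) → ℤ),
      cH • ∑ v ∈ box (3 + 1) (Lc ^ (j + 1)), divV (fun κ u => M2Of 3 (Lc ^ (j + 1)) (compMixG (ctrOff (3 + 1) Lc) Lc (j + 1)) 0 κ u ρ' w)
          ((((Lc ^ (j + 1) : ℕ) : ℤ)) • y + toSite v) -
        (comp ((fun μ w => cM 0 • compH (ctrOff (3 + 1) Lc) Lc (j + 1) μ w) ρ' w)
            (diagK (ξ • ∑ v ∈ box (3 + 1) (Lc ^ (j + 1)), legInd (toSite ((Roots.ctr Lc).s (j + 1))) ((((Lc ^ (j + 1) : ℕ) : ℤ)) • y + toSite v))) -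
          comp (diagK (ξ • ∑ v ∈ box (3 + 1) (Lc ^ (j + 1)), legInd (toSite ((Roots.ctr Lc).s (j + 1))) ((((Lc ^ (j + 1) : ℕ) : ℤ)) • y + toSite v)))
            ((fun μ w => cM 0 • compH (ctrOff (3 + 1) Lc) Lc (j + 1) μ w) ρ' w)) =
      cH • ∑ v ∈ box (3 + 1) (Lc ^ (j + 1)), divV (fun κ u => (1 : ℝ) • compMixFFG (fun k => symLinKerAt (toSite ((fun _ : ℕ => ctrOff (3 + 1) Lc) k)) Lc)
          (fun k => symVhKerAt (toSite ((fun _ : ℕ => ctrOff (3 + 1) Lc) k)) Lc) (fun k => symHessKerAt (toSite ((fun _ : ℕ => ctrOff (3 + 1) Lc) k)) Lc)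
          (fun k => symMixKerAt (toSite ((fun _ : ℕ => ctrOff (3 + 1) Lc) k)) Lc) Lc (j + 1) κ u ρ' w) ((((Lc ^ (j + 1) : ℕ) : ℤ)) • y + toSite v) -
        (comp (cM 0 • compHessFF (fun k => symLinKerAt (toSite ((fun _ : ℕ => ctrOff (3 + 1) Lc) k)) Lc) (fun k => symHessKerAt (toSite ((fun _ : ℕ => ctrOff (3 + 1) Lc) k)) Lc)
              Lc (j + 1) ρ' w)
            (diagK (ξ • ∑ v ∈ box (3 + 1) (Lc ^ (j + 1)), legInd (toSite ((Roots.ctr Lc).s (j + 1))) ((((Lc ^ (j + 1) : ℕ) : ℤ)) • y + toSite v))) -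
          comp (diagK (ξ • ∑ v ∈ box (3 + 1) (Lc ^ (j + 1)), legInd (toSite ((Roots.ctr Lc).s (j + 1))) ((((Lc ^ (j + 1) : ℕ) : ℤ)) • y + toSite v)))
            (cM 0 • compHessFF (fun k => symLinKerAt (toSite ((fun _ : ℕ => ctrOff (3 + 1) Lc) k)) Lc) (fun k => symHessKerAt (toSite ((fun _ : ℕ => ctrOff (3 + 1) Lc) k)) Lc)
              Lc (j + 1) ρ' w)) := by
    intro y ρ' w
    simp only [M2Of_member_zero, one_smul]
    rfl
  obtain ⟨CR, δR, hδR, hRM⟩ := vertexFamily_mixedLetterRemainder_sym (d := 3) (L := Lc) (r := fun _ : ℕ => ctrOff (3 + 1) Lc) hL hrc (Lc ^ (j + 1)) (j + 1)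
    (toSite ((Roots.ctr Lc).s (j + 1))) cH 1 (cM 0) ξ
  have hCR : 0 ≤ CR := (hRM 0 0 0).nonneg (Sum.inl 0)
  have hZ : ∀ Y : Fin (3 + 1) → ℤ, LocStencil ((fun (_ : Fin (3 + 1) → ℤ) (_ : Fin (3 + 1)) (_ : Fin (3 + 1) → ℤ) => (0 : MKer (3 + 1) (Fib 3))) Y) CR δR :=
    fun Y κ u => biLoc_weaken (biLoc_zero (F := Fib 3) u u δR) hCR le_rfl
  have hZp : ∀ (Y : Fin (3 + 1) → ℤ) (κ : Fin (3 + 1)) (u : Fin (3 + 1) → ℤ),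
      trK ((fun (_ : Fin (3 + 1) → ℤ) (_ : Fin (3 + 1)) (_ : Fin (3 + 1) → ℤ) => (0 : MKer (3 + 1) (Fib 3))) Y κ u) =
        -sgnK ((fun (_ : Fin (3 + 1) → ℤ) (_ : Fin (3 + 1)) (_ : Fin (3 + 1) → ℤ) => (0 : MKer (3 + 1) (Fib 3))) Y κ u) := fun _ _ _ => parityOdd_zero
  -- the border letters: PART 117 at the constant centred root list, composed root = the big root
  have hBo : ∀ (Y : Fin (3 + 1) → ℤ) (κ' : Fin (3 + 1)) (u' : Fin (3 + 1) → ℤ),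
      cH • ∑ v ∈ box (3 + 1) (Lc ^ (j + 1)), divV (fun κ u => cB • compB (ctrOff (3 + 1) Lc) Lc (j + 1) κ u κ' u') ((((Lc ^ (j + 1) : ℕ) : ℤ)) • Y + toSite v) =
        comp (cVH • compV (ctrOff (3 + 1) Lc) Lc (j + 1) κ' u') (diagK (ξ • ∑ v ∈ box (3 + 1) (Lc ^ (j + 1)), legInd (toSite ((Roots.ctr Lc).s (j + 1))) ((((Lc ^ (j + 1) : ℕ) : ℤ)) • Y + toSite v)))
          - comp (diagK (ξ • ∑ v ∈ box (3 + 1) (Lc ^ (j + 1)), legInd (toSite ((Roots.ctr Lc).s (j + 1))) ((((Lc ^ (j + 1) : ℕ) : ℤ)) • Y + toSite v))) (cVH • compV (ctrOff (3 + 1) Lc) Lc (j + 1) κ' u')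
          + (fun (_ : Fin (3 + 1) → ℤ) (_ : Fin (3 + 1)) (_ : Fin (3 + 1) → ℤ) => (0 : MKer (3 + 1) (Fib 3))) Y κ' u' := by
    intro Y κ' u'
    have h := hBord_compB_sym (d := 3) (r := fun _ : ℕ => ctrOff (3 + 1) Lc) hL hrc (j + 1) hlockB Y κ' u'
    rw [eR] at h
    exact h.trans (by simp only [add_zero]; rfl)
  have hBo'' : ∀ (Y : Fin (3 + 1) → ℤ) (κ : Fin (3 + 1)) (u : Fin (3 + 1) → ℤ),
      cH • ∑ v ∈ box (3 + 1) (Lc ^ (j + 1)), divV (fun κ' u' => cB • compB (ctrOff (3 + 1) Lc) Lc (j + 1) κ u κ' u') ((((Lc ^ (j + 1) : ℕ) : ℤ)) • Y + toSite v) =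
        comp (cVH • compV (ctrOff (3 + 1) Lc) Lc (j + 1) κ u) (diagK (ξ • ∑ v ∈ box (3 + 1) (Lc ^ (j + 1)), legInd (toSite ((Roots.ctr Lc).s (j + 1))) ((((Lc ^ (j + 1) : ℕ) : ℤ)) • Y + toSite v)))
          - comp (diagK (ξ • ∑ v ∈ box (3 + 1) (Lc ^ (j + 1)), legInd (toSite ((Roots.ctr Lc).s (j + 1))) ((((Lc ^ (j + 1) : ℕ) : ℤ)) • Y + toSite v))) (cVH • compV (ctrOff (3 + 1) Lc) Lc (j + 1) κ u)
          + (fun (_ : Fin (3 + 1) → ℤ) (_ : Fin (3 + 1)) (_ : Fin (3 + 1) → ℤ) => (0 : MKer (3 + 1) (Fib 3))) Y κ u := by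
    intro Y κ u
    have h := hBord''_compB_sym (d := 3) (r := fun _ : ℕ => ctrOff (3 + 1) Lc) hL hrc (j + 1) hlockB Y κ u
    rw [eR] at h
    exact h.trans (by simp only [add_zero]; rfl)
  -- the mixed remainder's parity: PART 111's sym instance under the lock
  have hRMp : ∀ (y : Fin (3 + 1) → ℤ) (ρ' : Fin (3 + 1)) (w : Fin (3 + 1) → ℤ),
      trK (cH • ∑ v ∈ box (3 + 1) (Lc ^ (j + 1)), divV (fun κ u => M2Of 3 (Lc ^ (j + 1)) (compMixG (ctrOff (3 + 1) Lc) Lc (j + 1)) 0 κ u ρ' w)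
          ((((Lc ^ (j + 1) : ℕ) : ℤ)) • y + toSite v) -
        (comp ((fun μ w => cM 0 • compH (ctrOff (3 + 1) Lc) Lc (j + 1) μ w) ρ' w)
            (diagK (ξ • ∑ v ∈ box (3 + 1) (Lc ^ (j + 1)), legInd (toSite ((Roots.ctr Lc).s (j + 1))) ((((Lc ^ (j + 1) : ℕ) : ℤ)) • y + toSite v))) -
          comp (diagK (ξ • ∑ v ∈ box (3 + 1) (Lc ^ (j + 1)), legInd (toSite ((Roots.ctr Lc).s (j + 1))) ((((Lc ^ (j + 1) : ℕ) : ℤ)) • y + toSite v)))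
            ((fun μ w => cM 0 • compH (ctrOff (3 + 1) Lc) Lc (j + 1) μ w) ρ' w))) =
      -sgnK (cH • ∑ v ∈ box (3 + 1) (Lc ^ (j + 1)), divV (fun κ u => M2Of 3 (Lc ^ (j + 1)) (compMixG (ctrOff (3 + 1) Lc) Lc (j + 1)) 0 κ u ρ' w)
          ((((Lc ^ (j + 1) : ℕ) : ℤ)) • y + toSite v) -
        (comp ((fun μ w => cM 0 • compH (ctrOff (3 + 1) Lc) Lc (j + 1) μ w) ρ' w)
            (diagK (ξ • ∑ v ∈ box (3 + 1) (Lc ^ (j + 1)), legInd (toSite ((Roots.ctr Lc).s (j + 1))) ((((Lc ^ (j + 1) : ℕ) : ℤ)) • y + toSite v))) -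
          comp (diagK (ξ • ∑ v ∈ box (3 + 1) (Lc ^ (j + 1)), legInd (toSite ((Roots.ctr Lc).s (j + 1))) ((((Lc ^ (j + 1) : ℕ) : ℤ)) • y + toSite v)))
            ((fun μ w => cM 0 • compH (ctrOff (3 + 1) Lc) Lc (j + 1) μ w) ρ' w))) := by
    intro y ρ' w
    rw [eRM y ρ' w]
    exact parityOdd_mixedLetterRemainder_sym (d := 3) hL hrc (Lc ^ (j + 1)) (j + 1) y (toSite ((Roots.ctr Lc).s (j + 1))) ρ' w hlockM
  subst hTW
  exact wardTransversal_AN_of_stencilLaw (Roots.ctr Lc) j (compV_hV (j + 1) hL hr) hH (compV_hVt (j + 1) hL) (compH_hHt (j + 1))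
    (fun κ u => trK_compVhS_sym (j + 1) κ u) (fun μ y => trK_compHessFF_sym (j + 1) μ y)
    hM hMt cE cVH cΛ cE₂ cB hM0 _ (compB_hB (j + 1) hL hr) (compB_hBt (j + 1) hL) (compMixG_hmix hL hr (j + 1)) (fun κ u μ w t => compMixG_translate (j + 1) κ u μ w t) ξ
    hSd
    (RW := fun _ _ _ => 0) (RW'' := fun _ _ _ => 0) (RB := fun _ _ _ => 0) (RB'' := fun _ _ _ => 0)
    (RM := fun y ρ' w => cH • ∑ v ∈ box (3 + 1) (Lc ^ (j + 1)), divV (fun κ u => M2Of 3 (Lc ^ (j + 1)) (compMixG (ctrOff (3 + 1) Lc) Lc (j + 1)) 0 κ u ρ' w)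
          ((((Lc ^ (j + 1) : ℕ) : ℤ)) • y + toSite v) -
        (comp ((fun μ w => cM 0 • compH (ctrOff (3 + 1) Lc) Lc (j + 1) μ w) ρ' w)
            (diagK (ξ • ∑ v ∈ box (3 + 1) (Lc ^ (j + 1)), legInd (toSite ((Roots.ctr Lc).s (j + 1))) ((((Lc ^ (j + 1) : ℕ) : ℤ)) • y + toSite v))) -
          comp (diagK (ξ • ∑ v ∈ box (3 + 1) (Lc ^ (j + 1)), legInd (toSite ((Roots.ctr Lc).s (j + 1))) ((((Lc ^ (j + 1) : ℕ) : ℤ)) • y + toSite v)))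
            ((fun μ w => cM 0 • compH (ctrOff (3 + 1) Lc) Lc (j + 1) μ w) ρ' w)))
    ⟨CR, δR, hδR, hZ, hZ, hZ, hZ, fun y ρ' w => by
      have h := hRM y ρ' w
      dsimp only at h ⊢
      rw [← eRM y ρ' w] at h
      exact h⟩
    hZp hZp hZp hZp hRMp
    (fun Y κ' u' => hWil_wsym22_TW_su (L := Lc ^ (j + 1)) hNc (toSite ((Roots.ctr Lc).s (j + 1))) hcE₂' Y κ' u')
    (fun Y κ u => hWil''_wsym22_TW_su (L := Lc ^ (j + 1)) hNc (toSite ((Roots.ctr Lc).s (j + 1))) hcE₂' Y κ u)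
    hBo hBo'' (fun y ρ' w => by dsimp only; abel)

end Sym

end Summit.QuantumFields.BalabanUV.Beta.FP.TowerNWardOfStencilLaw

end
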